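import Summits.BirchSwinnertonDyer.BirchSwinnertonDyer.Theorems.TeichmullerTwistDescentDefs
import Summits.BirchSwinnertonDyer.BirchSwinnertonDyer.Theorems.TeichmullerTwistDescentTypeLatticeCohomologySide
import Summits.BirchSwinnertonDyer.BirchSwinnertonDyer.Theorems.TeichmullerTwistDescentTwistedPeriodLatticeSaturationOfNoCaseOne
import HarnessLib

/-!
# Route `TeichmullerTwistDescent`, crux K `TwistedPeriodLatticeSaturation` (stmt-BirchSwinnertonDyer-25368):
# K ⟸ Modularity ∧ (a COHOMOLOGY-side tame-type lattice datum at every instance)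

Cell `pub/bsd-wall` (D-0145 line route-BirchSwinnertonDyer-TeichmullerTwistDescent, OPEN rev 7), seat `bsd-line-ttd-p1`
(prover 1/2, g22).  THEOREMS ONLY.  BSD is not proved by this file; K is NOT proved: it is reduced, granted Modularity,
to the existence at every instance of a `TameTypeCohomologyLatticeDatum` (`TeichmullerTwistDescentDefs`; socle
hypothesis = the Serre weight `C_W`, the form delivered by weights in cohomology) — parallel to `TypeLatticeDatumK`
(homology-side datum).  The datum is the typed content of the carriers (I1)–(I4), (I6); none is in the tree.

* `not_caseOne_of_cohomologyDatum`, `noCaseOne_of_cohomologyData` (registered signature of `stub_noCaseOne` verbatim),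
  **`twistedPeriodLatticeSaturation_of_modularity_of_cohomologyData`** (the route decl BY NAME),
  `ordinaryLowValuationGeEleven_of_facts_of_cohomologyData` (⟹ GE11 with the cite bundle 25370).
-/

set_option autoImplicit false
-- single-conjunct summit: `Summit.BirchSwinnertonDyer.BirchSwinnertonDyer.…` repeats the name by design
set_option linter.dupNamespace false

noncomputable section

open Function WeierstrassCurve
open Literature.NumberTheory.EllipticCurves Literature.NumberTheory.EllipticCurves.ModularForms
  Summit.BirchSwinnertonDyer.BirchSwinnertonDyer.Theses.TeichmullerTwistDescent

namespace Summit.BirchSwinnertonDyer.BirchSwinnertonDyer.Theorems.TeichmullerTwistDescent.TypeLatticeCohomologyDatumK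

/-- **A cohomology-side datum excludes «case one».** [cite: EmertonGeeSavitt2015, Lemma 4.1.1] [cite: Lang1990, Ch. 1 §2 Thm. 2.1] -/
theorem not_caseOne_of_cohomologyDatum (p : ℕ) [Fact p.Prime] (hp2 : p ≠ 2) {k : Type} [Field k] [CharP k p]
    [Algebra ℤ_[p] k] [Finite k] {Λf Λfχ : AddSubgroup ℂ} {g : ℂ}
    (d : TameTypeCohomologyLatticeDatum p k Λf Λfχ g) :
    ¬ (∀ w ∈ Λfχ, ∃ z ∈ Λf, g * w = (p : ℂ) * z) :=
  TypeLatticeCohomologySide.not_caseOne_of_cohomologyTypeLatticeDatum p hp2 d.hb d.hb2 d.hsurj d.halg d.Λc d.hm d.hsoc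
    g d.hframe d.βW d.βV d.hβW d.hβV d.hβ

/-- **`stub_noCaseOne` (registered signature, verbatim) from a cohomology-side datum at every instance.**
[cite: EdixhovenManin1991, §4] -/
theorem noCaseOne_of_cohomologyData
    (hdat : ∀ (W : WeierstrassCurve ℚ) [W.IsElliptic] [W.IsGloballyMinimal] (p : ℕ) [Fact p.Prime]
      [NeZero (W.conductorNorm ℤ)] (D : ModularParametrizationData W (W.conductorNorm ℤ))
      (hsq : p ^ 2 ∣ W.conductorNorm ℤ), 11 ≤ p → Rank1Residual.Addv W p → Rank1Residual.Irr W p →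
      Summit.BirchSwinnertonDyer.Rank1Residual.Additive.TypeGOrd W p →
      padicValInt p W.minimalDiscriminantInt ≤ 4 →
      (∀ z ∈ D.L.lattice, ∃ w ∈ periodLattice D.f, z = D.c * w) →
      ∀ (χ : DirichletCharacter ℂ p) (hχ : χ.IsQuadratic), χ.IsPrimitive →
        ∃ (k : Type) (_ : Field k) (_ : CharP k p) (_ : Algebra ℤ_[p] k) (_ : Finite k),
          Nonempty (TameTypeCohomologyLatticeDatum p k (periodLattice D.f)
            (periodLattice (charTwist (W.conductorNorm ℤ) (dvd_refl _) hsq hχ D.f))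
            (gaussSum χ (ZMod.stdAddChar (N := p))))) :
    ∀ (W : WeierstrassCurve ℚ) [W.IsElliptic] [W.IsGloballyMinimal] (p : ℕ) [Fact p.Prime]
      [NeZero (W.conductorNorm ℤ)] (D : ModularParametrizationData W (W.conductorNorm ℤ))
      (hsq : p ^ 2 ∣ W.conductorNorm ℤ), 11 ≤ p → Rank1Residual.Addv W p → Rank1Residual.Irr W p →
      Summit.BirchSwinnertonDyer.Rank1Residual.Additive.TypeGOrd W p →
      padicValInt p W.minimalDiscriminantInt ≤ 4 →
      (∀ z ∈ D.L.lattice, ∃ w ∈ periodLattice D.f, z = D.c * w) →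
      ∀ (χ : DirichletCharacter ℂ p) (hχ : χ.IsQuadratic), χ.IsPrimitive →
        ¬ (∀ w ∈ periodLattice (charTwist (W.conductorNorm ℤ) (dvd_refl _) hsq hχ D.f),
            ∃ z ∈ periodLattice D.f, gaussSum χ (ZMod.stdAddChar (N := p)) * w = (p : ℂ) * z) := by
  intro W _ _ p _ _ D hsq hp11 hadd hirr hGo hV4 hopt χ hχ hprim
  obtain ⟨k, hk₁, hk₂, hk₃, hk₄, ⟨d⟩⟩ := hdat W p D hsq hp11 hadd hirr hGo hV4 hopt χ hχ hprim
  exact not_caseOne_of_cohomologyDatum p (by omega) d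

/-- **K ⟸ Modularity ∧ cohomology-side data** (the route decl of crux K by name).
[cite: EdixhovenManin1991, §4] [cite: EmertonGeeSavitt2015, Lemma 4.1.1] -/
theorem twistedPeriodLatticeSaturation_of_modularity_of_cohomologyData (hnf : exists_isNewformOf)
    (hdat : ∀ (W : WeierstrassCurve ℚ) [W.IsElliptic] [W.IsGloballyMinimal] (p : ℕ) [Fact p.Prime]
      [NeZero (W.conductorNorm ℤ)] (D : ModularParametrizationData W (W.conductorNorm ℤ))
      (hsq : p ^ 2 ∣ W.conductorNorm ℤ), 11 ≤ p → Rank1Residual.Addv W p → Rank1Residual.Irr W p →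
      Summit.BirchSwinnertonDyer.Rank1Residual.Additive.TypeGOrd W p →
      padicValInt p W.minimalDiscriminantInt ≤ 4 →
      (∀ z ∈ D.L.lattice, ∃ w ∈ periodLattice D.f, z = D.c * w) →
      ∀ (χ : DirichletCharacter ℂ p) (hχ : χ.IsQuadratic), χ.IsPrimitive →
        ∃ (k : Type) (_ : Field k) (_ : CharP k p) (_ : Algebra ℤ_[p] k) (_ : Finite k),
          Nonempty (TameTypeCohomologyLatticeDatum p k (periodLattice D.f)
            (periodLattice (charTwist (W.conductorNorm ℤ) (dvd_refl _) hsq hχ D.f))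
            (gaussSum χ (ZMod.stdAddChar (N := p))))) :
    TwistedPeriodLatticeSaturation :=
  twistedPeriodLatticeSaturation_of_modularity_of_noCaseOne hnf (noCaseOne_of_cohomologyData hdat)

/-- **GE11 ⟸ `EdixhovenKodairaAndModularityFacts` (stmt-25370) ∧ cohomology-side data.**
[cite: EdixhovenManin1991, Thm. 3 and §4] -/
theorem ordinaryLowValuationGeEleven_of_facts_of_cohomologyData (hF : EdixhovenKodairaAndModularityFacts)
    (hdat : ∀ (W : WeierstrassCurve ℚ) [W.IsElliptic] [W.IsGloballyMinimal] (p : ℕ) [Fact p.Prime]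
      [NeZero (W.conductorNorm ℤ)] (D : ModularParametrizationData W (W.conductorNorm ℤ))
      (hsq : p ^ 2 ∣ W.conductorNorm ℤ), 11 ≤ p → Rank1Residual.Addv W p → Rank1Residual.Irr W p →
      Summit.BirchSwinnertonDyer.Rank1Residual.Additive.TypeGOrd W p →
      padicValInt p W.minimalDiscriminantInt ≤ 4 →
      (∀ z ∈ D.L.lattice, ∃ w ∈ periodLattice D.f, z = D.c * w) →
      ∀ (χ : DirichletCharacter ℂ p) (hχ : χ.IsQuadratic), χ.IsPrimitive →
        ∃ (k : Type) (_ : Field k) (_ : CharP k p) (_ : Algebra ℤ_[p] k) (_ : Finite k),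
          Nonempty (TameTypeCohomologyLatticeDatum p k (periodLattice D.f)
            (periodLattice (charTwist (W.conductorNorm ℤ) (dvd_refl _) hsq hχ D.f))
            (gaussSum χ (ZMod.stdAddChar (N := p))))) :
    OrdinaryLowValuationOptimalManinUnitGeEleven :=
  ordinaryLowValuationGeEleven_of_facts_of_noCaseOne hF (noCaseOne_of_cohomologyData hdat)

end Summit.BirchSwinnertonDyer.BirchSwinnertonDyer.Theorems.TeichmullerTwistDescent.TypeLatticeCohomologyDatumK
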